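import Mathlib

/-!
# `OrigamiRung` — negative-side support: meridian pinch, Hantzsche doubling, SW-free genus table

Crux `SymplecticOrigami.OrigamiRung` (item stmt-SmoothPoincare4-7843), cdisprove seat (gen 2).
Small-model / arithmetic facts isolating the part of the rung's sieve that replaces the route's
Seiberg–Witten inputs (Liu 1996 Thm A/B, Taubes SW = Gr), for provers to import:

* `not_isAddCyclic_zmod_prod`, `meridian_pinch`: for `m ≥ 2`, `ℤ/m ⊕ ℤ/m` does not embed in a
  cyclic group.  In the rung: the two meridians `μ₀, μ₁` have order exactly `m` (`m` = divisibility
  of `[Bᵢ] = mH`) in `Tors H₁(W₀) ⊕ Tors H₁(W₁) ≅ Tors H₁(Z) ≅ ℤ/m²` (cyclic, `e = m²`), so `m = 1`: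
  the collapsed fold is a primitive `(+1)`-surface and `e = 1` — no `K·[ω]` sign argument needed
  to remove the conic (`g = 0, m = 2`) or the `K = −H` (`g = 2, m = 2`) ghosts of `genusTable`.
* `hantzsche_cyclic`: `ℤ/e ≅ T ⊕ T` with `T` finite forces `e = 1` (Hantzsche's doubling
  `Tors H₁(Z) ≅ T ⊕ T` for a closed 3-manifold in a homology 4-sphere, in miniature).
* `swFreeGenusTable`: with `kᵢ = c₁(Nᵢ)·H` constrained only by `kᵢ² = c₁² = 2χ + 3σ = 9 − 4b₁(Nᵢ)`
  (rank-one positive lattice) and adjunction `2g − 2 = m² + kᵢ m` on both pieces, plus the pinch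
  `b₁(N₀) + b₁(N₁) = 2g`: only `g = 0` (both `b₁ = 0`, `k = −3`, `m ∈ {1,2}`) or `g = 2`
  (both `b₁ = 2`, `(m,k) ∈ {(1,1),(2,−1)}`) survive — `b₁ ≤ 2` and `b₁` even are OUTPUTS here,
  not Liu's theorem; `swFreeDichotomy`: with `m = 1` (meridian pinch) the dichotomy is
  `(g, b₁, k) = (0, 0, −3)` or `(2, 2, 1)` on both pieces.
-/

-- the prescribed namespace `Summit.<P>.<Sub>.…` duplicates `SmoothPoincare4` (P = Sub)
set_option linter.dupNamespace false

namespace Summit.SmoothPoincare4.SmoothPoincare4.Theorems.OrigamiRung.Negative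

/-- Every element of `ℤ/m ⊕ ℤ/m` is killed by `m`. [folklore] -/
theorem nsmul_self_zmod_prod (m : ℕ) (x : ZMod m × ZMod m) : m • x = 0 := by
  ext <;> simp

/-- `ℤ/m ⊕ ℤ/m` is not cyclic for `m ≥ 2`: a generator would have order `m²`, yet every
element is killed by `m`. [folklore] -/
theorem not_isAddCyclic_zmod_prod (m : ℕ) (hm : 2 ≤ m) : ¬ IsAddCyclic (ZMod m × ZMod m) := by
  intro hc
  haveI : NeZero m := ⟨by omega⟩
  obtain ⟨g, hg⟩ := IsAddCyclic.exists_generator (α := ZMod m × ZMod m)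
  have hcard : addOrderOf g = Nat.card (ZMod m × ZMod m) :=
    addOrderOf_eq_card_of_forall_mem_zmultiples hg
  have hdvd : addOrderOf g ∣ m := addOrderOf_dvd_of_nsmul_eq_zero (nsmul_self_zmod_prod m g)
  rw [hcard, Nat.card_prod, Nat.card_zmod] at hdvd
  have hle : m * m ≤ m := Nat.le_of_dvd (by omega) hdvd
  nlinarith

/-- **Meridian pinch (small model).** For `m ≥ 2` there is no injective additive map
`ℤ/m ⊕ ℤ/m →+ G` into a cyclic group `G` (its image would be a cyclic copy of `ℤ/m ⊕ ℤ/m`).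
In the rung `G = Tors H₁(Z) ≅ ℤ/m²` and the map is `(x, y) ↦ x μ₀ + y μ₁` through the
Mayer–Vietoris isomorphism; hence `m = 1`, `e = B² = 1`. [folklore] -/
theorem meridian_pinch {G : Type*} [AddCommGroup G] [IsAddCyclic G] (m : ℕ) (hm : 2 ≤ m)
    (f : ZMod m × ZMod m →+ G) : ¬ Function.Injective f := by
  intro hf
  apply not_isAddCyclic_zmod_prod m hm
  have e : (ZMod m × ZMod m) ≃+ f.range := AddMonoidHom.ofInjective hf
  exact isAddCyclic_of_surjective e.symm e.symm.surjective

/-- **Hantzsche doubling (small model).** If `ℤ/e ≃ T ⊕ T` as abelian groups with `T` finite,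
then `e = 1` (`e = 0`, i.e. `ℤ`, is excluded by finiteness; for `e ≥ 1`, `T ⊕ T` is cyclic of
order `|T|²` but killed by `|T|`).  In the rung: `Tors H₁(S(νB)) = ℤ/e` must double because the
fold `Z` sits in a homology 4-sphere, so `e = 1`. [folklore] -/
theorem hantzsche_cyclic (e : ℕ) (T : Type*) [AddCommGroup T] [Finite T]
    (φ : ZMod e ≃+ T × T) : e = 1 := by
  rcases Nat.eq_zero_or_pos e with rfl | he
  · exfalso
    haveI : Finite (ZMod 0) := Finite.of_equiv _ φ.toEquiv.symm
    exact not_finite (ZMod 0)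
  haveI : NeZero e := ⟨by omega⟩
  haveI hc : IsAddCyclic (T × T) := isAddCyclic_of_surjective φ φ.surjective
  obtain ⟨g, hg⟩ := IsAddCyclic.exists_generator (α := T × T)
  have hcard : addOrderOf g = Nat.card (T × T) := addOrderOf_eq_card_of_forall_mem_zmultiples hg
  have hT : ∀ x : T, Nat.card T • x = 0 := fun x => card_nsmul_eq_zero'
  have hdvd : addOrderOf g ∣ Nat.card T := by
    apply addOrderOf_dvd_of_nsmul_eq_zero
    ext <;> simp [hT]
  rw [hcard, Nat.card_prod] at hdvd
  have hpos : 0 < Nat.card T := Nat.card_pos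
  have hle : Nat.card T * Nat.card T ≤ Nat.card T := Nat.le_of_dvd hpos hdvd
  have h1 : Nat.card T = 1 := by nlinarith
  have : Nat.card (ZMod e) = 1 := by
    rw [Nat.card_congr φ.toEquiv, Nat.card_prod, h1]
  simpa [Nat.card_zmod] using this

/-- **SW-free genus table.**  Per piece `i`: `aᵢ = b₁(Nᵢ)`, `kᵢ = c₁(Nᵢ)·H ∈ ℤ` with
`kᵢ² = c₁² = 2χ + 3σ = 2(3 − 2aᵢ) + 3 = 9 − 4aᵢ` (`b₂ = b⁺ = 1`, form `⟨+1⟩`), adjunction for the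
genus-`g` symplectic surface `Bᵢ = mH`: `2g − 2 = Bᵢ² − c₁·Bᵢ`, written with `kᵢ := −c₁·H` as
`2g − 2 = m² + kᵢ m` (so `kᵢ = K·H`), the SAME `m ≥ 1` on both sides (`Tors H₁(Z) = ℤ/m²`), and the
pinch `a₀ + a₁ = 2g`.  Output, with no Seiberg–Witten input and no a-priori bound on `b₁`:
`g = 0`, both `b₁ = 0`, `K·H = −3`, `m ∈ {1, 2}`; or `g = 2`, both `b₁ = 2`,
`(m, K·H) ∈ {(1, 1), (2, −1)}`.  (`g = 1` dies: the two adjunctions force `k₀ = k₁`, hence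
`a₀ = a₁ = 1`, and `k² = 5` has no solution.) [folklore] -/
theorem swFreeGenusTable (g m a₀ a₁ : ℕ) (k₀ k₁ : ℤ) (hm : 1 ≤ m) (hsum : a₀ + a₁ = 2 * g)
    (hk₀ : k₀ ^ 2 = 9 - 4 * (a₀ : ℤ)) (hk₁ : k₁ ^ 2 = 9 - 4 * (a₁ : ℤ))
    (adj₀ : 2 * (g : ℤ) - 2 = (m : ℤ) ^ 2 + k₀ * m)
    (adj₁ : 2 * (g : ℤ) - 2 = (m : ℤ) ^ 2 + k₁ * m) :
    (g = 0 ∧ a₀ = 0 ∧ a₁ = 0 ∧ k₀ = -3 ∧ k₁ = -3 ∧ (m = 1 ∨ m = 2)) ∨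
      (g = 2 ∧ a₀ = 2 ∧ a₁ = 2 ∧
        ((m = 1 ∧ k₀ = 1 ∧ k₁ = 1) ∨ (m = 2 ∧ k₀ = -1 ∧ k₁ = -1))) := by
  have hm' : (1 : ℤ) ≤ m := by exact_mod_cast hm
  have hk : k₀ = k₁ := by
    have h : (k₀ - k₁) * (m : ℤ) = 0 := by linarith
    rcases mul_eq_zero.mp h with h | h <;> linarith
  subst hk
  have ha0 : (0 : ℤ) ≤ a₀ := by positivity
  have ha : (a₀ : ℤ) = a₁ := by linarith
  have ha' : a₀ = a₁ := by exact_mod_cast ha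
  have ha2 : a₀ ≤ 2 := by
    have : (a₀ : ℤ) ≤ 2 := by nlinarith [sq_nonneg k₀]
    exact_mod_cast this
  have hg : g ≤ 2 := by omega
  have hku : k₀ ≤ 3 := by nlinarith [sq_nonneg (k₀ - 4)]
  have hkl : -3 ≤ k₀ := by nlinarith [sq_nonneg (k₀ + 4)]
  have hm3 : m ≤ 3 := by
    by_contra h
    have h4 : (4 : ℤ) ≤ m := by exact_mod_cast (by omega : 4 ≤ m)
    have hg' : (g : ℤ) ≤ 2 := by exact_mod_cast hg
    nlinarith [mul_nonneg (by linarith : (0 : ℤ) ≤ (m : ℤ) - 4) (by linarith : (0 : ℤ) ≤ (m : ℤ) - 4),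
      mul_nonneg (by linarith : (0 : ℤ) ≤ k₀ + 3) (by linarith : (0 : ℤ) ≤ (m : ℤ))]
  interval_cases g <;> interval_cases k₀ <;> interval_cases m <;> norm_num at * <;> omega

/-- **SW-free dichotomy.**  `swFreeGenusTable` with the meridian pinch's `m = 1`: both pieces are
`(g, b₁, K·H) = (0, 0, −3)` (homology `(ℂP², line)`) or both are `(2, 2, +1)` (doors, `K = H = [B]`).
This is the rung's dichotomy with Liu 1996 Thm A/B and Taubes' SW = Gr removed from the inputs;
what remains deep is only the genus-0 recognition (McDuff's pair theorem / Gromov) and `Γ₄ = 0`.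
[folklore] -/
theorem swFreeDichotomy (g a₀ a₁ : ℕ) (k₀ k₁ : ℤ) (hsum : a₀ + a₁ = 2 * g)
    (hk₀ : k₀ ^ 2 = 9 - 4 * (a₀ : ℤ)) (hk₁ : k₁ ^ 2 = 9 - 4 * (a₁ : ℤ))
    (adj₀ : 2 * (g : ℤ) - 2 = 1 + k₀) (adj₁ : 2 * (g : ℤ) - 2 = 1 + k₁) :
    (g = 0 ∧ a₀ = 0 ∧ a₁ = 0 ∧ k₀ = -3 ∧ k₁ = -3) ∨
      (g = 2 ∧ a₀ = 2 ∧ a₁ = 2 ∧ k₀ = 1 ∧ k₁ = 1) := by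
  rcases swFreeGenusTable g 1 a₀ a₁ k₀ k₁ le_rfl hsum hk₀ hk₁ (by push_cast; linarith)
    (by push_cast; linarith) with h | h
  · exact Or.inl ⟨h.1, h.2.1, h.2.2.1, h.2.2.2.1, h.2.2.2.2.1⟩
  · rcases h.2.2.2 with h' | h'
    · exact Or.inr ⟨h.1, h.2.1, h.2.2.1, h'.2.1, h'.2.2⟩
    · exact absurd h'.1 (by norm_num)

end Summit.SmoothPoincare4.SmoothPoincare4.Theorems.OrigamiRung.Negative
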